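import Summits.BirchSwinnertonDyer.BirchSwinnertonDyer.Theorems.ThetaPartnerAtTwoSignedControlAtTwoMuRealUnipotentTwo
import Summits.BirchSwinnertonDyer.BirchSwinnertonDyer.Theorems.KolyvaginRoadThreePTMilneOfCardSq
import Mathlib.NumberTheory.NumberField.InfinitePlace.TotallyRealComplex
import HarnessLib

/-!
# Milne *ADT* I Thm. 4.10(b) `Ker γ¹ ⊆ Im β¹` for EVERY module of order `p²` killed by `p` over a TOTALLY COMPLEX
# number field — every prime `p`, INCLUDING `p = 2` (e.g. `E[2]` over an imaginary quadratic field, any `E`)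

Route `ThetaPartnerAtTwo`, crux K4 `SignedControlAtTwo` (stmt-BirchSwinnertonDyer-20309), line `eulerchar` v11, lead
`bsd-wall-tp2-p3` g4 (`--supports stmt-BirchSwinnertonDyer-20309`, helper).  File 10 of the real-place packet.

bsd-stepL koly's END of the PT road, `middleExact_canonical_of_card_eq_sq (hodd : Odd p)` (Milne I 4.10(b) for `#M = p²`,
`p·M = 0`, THE invariant maps, every admissible `S` — dévissage over the `p`-Sylow field `K''` + prime-to-`p` descent with its
nine binders), uses `Odd p` at exactly TWO points: (1) the descent binder `hKinf : H¹(K_v, M) = 0` at the infinite places of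
`K` (`galoisCohomology_toLocal_inl_eq_zero_of_odd`), and (2) the trivial base case inside
`middleExact_canonical_of_unipotentTwo_all (fun _ _ => hodd)`.  For a TOTALLY COMPLEX `K`, (1) holds for every `p`
(`galoisCohomology_inl_eq_zero_of_isComplex`), and (2) is free of parity since file 4
(`middleExact_canonical_of_unipotentTwo_all_real`).  Hence:

* **`middleExact_canonical_of_card_eq_sq_of_isTotallyComplex`** — Milne I 4.10(b) `Ker γ¹ ⊆ Im β¹` for every finite discrete
  `Γ_K`-module `M` with `p·M = 0`, `#M = p²`, THE canonical invariant maps `LocalInvariants.canonical K p`, every admissible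
  `S`, over every TOTALLY COMPLEX number field `K`, EVERY prime `p` — in particular `p = 2`;
* `middleExact_canonical_torsionGaloisModule_of_isTotallyComplex` — the instance `M = E[p]` for every elliptic curve `E/K`
  (every `p`; `#E[p] = p²`), e.g. `E[2]` over an imaginary quadratic field (the Heegner / Kolyvagin-at-2 settings).

Proof: koly's proof of `middleExact_canonical_of_card_eq_sq` VERBATIM with the two substitutions.  HONEST FRAMING: THEOREMS ONLY;
fields WITH real places at `p = 2` (K4's `ℚ`) still need the archimedean descent bricks (certificate p610051); no item closes; BSD is
not proved by any of this.

References: [MilneADT2006] I Thm. 4.10(b); [SerreGaloisCohomology1997] I §2.4, II §6; [CasselsFrohlichANT1967] IV §6, VII;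
[SilvermanAEC2009] III.6.4.
-/

noncomputable section

open CategoryTheory Function NumberField IsDedekindDomain Field
open scoped NumberField ContRepresentation Classical

set_option linter.dupNamespace false
set_option autoImplicit false

namespace Summit.BirchSwinnertonDyer.BirchSwinnertonDyer.Theorems.SignedEC.MuReal

open Literature.NumberTheory.GaloisRepresentations Literature.NumberTheory.GaloisCohomology
open Literature.NumberTheory.GaloisRepresentations.DiscreteGaloisModule (mu MuCarrier TateDual tateDual
  unramifiedSubgroup localTatePairingZMod homOfIntertwining)
open Literature.NumberTheory.GaloisRepresentations.SemiLocal (Place)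
open Summit.BirchSwinnertonDyer.BirchSwinnertonDyer.Theorems.KolyvaginRoadThreePT
open Summit.BirchSwinnertonDyer.Rank1Residual.JET.GlobalDuality
open Literature.NumberTheory.EllipticCurves WeierstrassCurve

variable {K : Type} [Field K] [NumberField K] {p : ℕ} [hp : Fact p.Prime]
variable {M : Type} [AddCommGroup M] [TopologicalSpace M] [DiscreteTopology M] [Finite M]


/-- **Milne I Thm. 4.10(b) `Ker γ¹ ⊆ Im β¹` for every finite discrete `Γ_K`-module `M` with `p · M = 0` and `#M = p²` over a
TOTALLY COMPLEX number field `K`, EVERY prime `p` (incl. `p = 2`), THE local Tate pairings, every admissible `S`.**  koly's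
`middleExact_canonical_of_card_eq_sq` with `Odd p` replaced by `IsTotallyComplex K` (infinite places: `H¹(K_v, M) = 0` at complex
`v`) and the base case by `middleExact_canonical_of_unipotentTwo_all_real`. [cite: MilneADT2006, Ch. I, Thm. 4.10(b)] -/
theorem middleExact_canonical_of_card_eq_sq_of_isTotallyComplex [IsTotallyComplex K] (ρ : DiscreteGaloisModule K M)
    (hpM : ∀ m : M, p • m = 0) (hcard : Nat.card M = p ^ 2)
    {S : Finset (Place K)}
    (hS : ∀ v : HeightOneSpectrum (𝓞 K), (Sum.inr v : Place K) ∉ S →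
      ((p : ℕ) : 𝓞 K) ∉ v.asIdeal ∧ GaloisRep.IsUnramifiedAt v ρ)
    (t : Π v : Place K, galoisCohomology (ρ.toLocal v) 1)
    (horth : ∀ y : galoisCohomology (ρ.tateDual p) 1,
      (∀ v : HeightOneSpectrum (𝓞 K), (Sum.inr v : Place K) ∉ S →
        galoisCohomology.localization (ρ.tateDual p) (Sum.inr v) 1 y ∈
          unramifiedSubgroup (GaloisRep.toLocal v (ρ.tateDual p)) 1) →
      ∑ v ∈ S, localTatePairingZMod ρ p v (LocalInvariants.canonical K p v) (t v)
        (galoisCohomology.localization (ρ.tateDual p) v 1 y) = 0) :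
    ∃ x : galoisCohomology ρ 1,
      (∀ v : HeightOneSpectrum (𝓞 K), (Sum.inr v : Place K) ∉ S →
        galoisCohomology.localization ρ (Sum.inr v) 1 x ∈ unramifiedSubgroup (GaloisRep.toLocal v ρ) 1) ∧
      ∀ v ∈ S, galoisCohomology.localization ρ v 1 x = t v := by
  haveI : NeZero p := ⟨hp.out.ne_zero⟩
  -- Step 1: the open normal subgroup `U` and the `p`-Sylow fixed field `K'' = K̄^H`
  haveI : (jointKer (p := p) ρ).Normal := MonoidHom.normal_ker _
  obtain ⟨H, hH, hcop, hpowH, hpowres⟩ :=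
    exists_fixedField_coprime_pow_mem' (p := p) (jointKer (p := p) ρ) (isOpen_jointKer ρ)
  haveI : FiniteDimensional K (IntermediateField.fixedField H : IntermediateField K (AlgebraicClosure K)) :=
    finiteDimensional_fixedField_of_isOpen H hH
  haveI : NumberField (IntermediateField.fixedField H : IntermediateField K (AlgebraicClosure K)) :=
    NumberField.of_module_finite K _
  -- Step 2: `Γ_{K''}` acts on `M` through elements of `p`-power order
  have hpowM : ∀ σ : absoluteGaloisGroup (IntermediateField.fixedField H : IntermediateField K (AlgebraicClosure K)),
      ∃ k : ℕ, ((ρ.restrictField (IntermediateField.fixedField H :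
        IntermediateField K (AlgebraicClosure K))) σ) ^ (p ^ k) = 1 := fun σ => by
    obtain ⟨k, hk⟩ := hpowres σ
    refine ⟨k, ?_⟩
    rw [GaloisRep.restrictField_apply, ← map_pow]
    exact LinearMap.ext fun m => ((mem_jointKer_iff (p := p) ρ _).mp hk).1 m
  -- `μₚ ⊂ K''`
  obtain ⟨ζ₀, hζ₀⟩ := HasEnoughRootsOfUnity.exists_primitiveRoot (AlgebraicClosure K) p
  set u₀ : (AlgebraicClosure K)ˣ := (hζ₀.isUnit hp.out.ne_zero).unit with hu₀def
  have hu₀val : (u₀ : AlgebraicClosure K) = ζ₀ := IsUnit.unit_spec _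
  have hu₀ : u₀ ^ p = 1 := Units.ext (by
    rw [Units.val_pow_eq_pow_val, hu₀val, Units.val_one]; exact hζ₀.pow_eq_one)
  have hζmem : ζ₀ ∈ (IntermediateField.fixedField H : IntermediateField K (AlgebraicClosure K)) := by
    rw [IntermediateField.mem_fixedField_iff]
    intro h hh
    obtain ⟨k, hk⟩ := hpowH h hh
    have hμk : ∀ z : MuCarrier K p, mu K p (h ^ (p ^ k)) z = z := ((mem_jointKer_iff (p := p) ρ _).mp hk).2
    have hu : ((mu K p).toRepresentation.asGroupHom h) ^ (p ^ k) = 1 := by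
      rw [← map_pow]
      exact Units.ext (LinearMap.ext fun z => by rw [Representation.asGroupHom_apply]; exact hμk z)
    haveI : Finite (MuCarrier K p) :=
      Nat.finite_of_card_ne_zero (by rw [natCard_muCarrier]; exact NeZero.ne p)
    have hz := units_apply_eq_self_of_pow_eq_one (natCard_muCarrier K p) _ hu (muOfUnit K p u₀ hu₀)
    rw [Representation.asGroupHom_apply] at hz
    have hval := congrArg (fun z => ((muVal K p z : (AlgebraicClosure K)ˣ) : AlgebraicClosure K)) hz
    simp only [muVal_muOfUnit, hu₀val] at hval
    exact hval
  have hζ : IsPrimitiveRoot (⟨ζ₀, hζmem⟩ :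
      (IntermediateField.fixedField H : IntermediateField K (AlgebraicClosure K))) p :=
    (IsPrimitiveRoot.map_iff_of_injective
      (f := algebraMap (IntermediateField.fixedField H : IntermediateField K (AlgebraicClosure K))
        (AlgebraicClosure K)) Subtype.val_injective).mp hζ₀
  -- Step 3: the unipotent filtration of `M|_{Γ_{K''}}`
  obtain ⟨A, B, _, _, _, _, _, _, _, _, ρA, ρB, f, g, hA, hB, hcA, hcB, hpA, hpB, hSES⟩ :=
    exists_unipotentTwo_data (τ := ρ.restrictField (IntermediateField.fixedField H :
      IntermediateField K (AlgebraicClosure K))) hpM hcard hpowM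
  haveI := DiscreteGaloisModule.TateDual.finite
    (IntermediateField.fixedField H : IntermediateField K (AlgebraicClosure K)) B p
  -- Step 4: the descent; the infinite places of the totally complex `K` carry no `H¹`
  refine middleExact_canonical_of_descentData (K' := (IntermediateField.fixedField H :
      IntermediateField K (AlgebraicClosure K))) ρ (ρ.restrictField _) hpM hcop
    (galoisCohomology.cor ρ _) (globalCorDual (p := p) ρ)
    (fun v w => localCor v w ρ) (fun v w => localRes v w ρ) (fun v w => localCorDual (p := p) ρ v w)
    (fun v y' => localization_cor_eq_sum_localCor v ρ y')
    (fun v y' => localization_globalCorDual_eq_sum_localCorDual v ρ y')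
    (fun v a => sum_localCor_localRes v ρ a)
    (fun v w a b' => localTatePairingZMod_localRes_eq_localCorDual (p := p) ρ v w a b')
    (fun v w z' hz' => localCor_mem_unramifiedSubgroup v w ρ z' hz')
    (fun v w z' hz' => localCorDual_mem_unramifiedSubgroup (p := p) ρ v w z' hz')
    (fun v w h => isUnramifiedAt_restrictField_place ρ v w h)
    (fun winf a => galoisCohomology_inl_eq_zero_of_isComplex ρ (IsTotallyComplex.isComplex winf) a)
    (fun S' hS'inf hS' t' horth' => ?_) hS t horth
  exact middleExact_canonical_of_unipotentTwo_all_real hζ ρA (ρ.restrictField _) ρB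
    hA hB hcA hcB hpA hpM hpB hSES hS'inf hS' t' horth'

/-- **Milne I Thm. 4.10(b) for `E[p]` over a TOTALLY COMPLEX number field, every prime `p` (incl. `p = 2`), every elliptic
curve `E/K`**, THE canonical maps, every admissible `S` (`#E[p] = p²`, `p · E[p] = 0`) — e.g. `E[2]` over an imaginary quadratic
field. [cite: MilneADT2006, Ch. I, Thm. 4.10(b)] [cite: SilvermanAEC2009, Cor. III.6.4(b)] -/
theorem middleExact_canonical_torsionGaloisModule_of_isTotallyComplex [IsTotallyComplex K] (W : WeierstrassCurve K)
    [W.IsElliptic] [Finite (geomTorsion W (p : ℤ))]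
    {S : Finset (Place K)}
    (hS : ∀ v : HeightOneSpectrum (𝓞 K), (Sum.inr v : Place K) ∉ S →
      ((p : ℕ) : 𝓞 K) ∉ v.asIdeal ∧ GaloisRep.IsUnramifiedAt v (W.torsionGaloisModule (p : ℤ)))
    (t : Π v : Place K, galoisCohomology ((W.torsionGaloisModule (p : ℤ)).toLocal v) 1)
    (horth : ∀ y : galoisCohomology ((W.torsionGaloisModule (p : ℤ)).tateDual p) 1,
      (∀ v : HeightOneSpectrum (𝓞 K), (Sum.inr v : Place K) ∉ S →
        galoisCohomology.localization ((W.torsionGaloisModule (p : ℤ)).tateDual p) (Sum.inr v) 1 y ∈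
          unramifiedSubgroup (GaloisRep.toLocal v ((W.torsionGaloisModule (p : ℤ)).tateDual p)) 1) →
      ∑ v ∈ S, localTatePairingZMod (W.torsionGaloisModule (p : ℤ)) p v (LocalInvariants.canonical K p v) (t v)
        (galoisCohomology.localization ((W.torsionGaloisModule (p : ℤ)).tateDual p) v 1 y) = 0) :
    ∃ x : galoisCohomology (W.torsionGaloisModule (p : ℤ)) 1,
      (∀ v : HeightOneSpectrum (𝓞 K), (Sum.inr v : Place K) ∉ S →
        galoisCohomology.localization (W.torsionGaloisModule (p : ℤ)) (Sum.inr v) 1 x ∈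
          unramifiedSubgroup (GaloisRep.toLocal v (W.torsionGaloisModule (p : ℤ))) 1) ∧
      ∀ v ∈ S, galoisCohomology.localization (W.torsionGaloisModule (p : ℤ)) v 1 x = t v :=
  middleExact_canonical_of_card_eq_sq_of_isTotallyComplex (W.torsionGaloisModule (p : ℤ))
    (fun P => Subtype.ext (by
      have h := (mem_geomTorsion_iff W (p : ℤ) (P : geomPoints W)).mp P.2
      rw [natCast_zsmul] at h
      exact h))
    (by
      haveI : NeZero (p : K) := ⟨Nat.cast_ne_zero.mpr hp.out.ne_zero⟩
      exact Literature.NumberTheory.EllipticCurves.natCard_geomTorsion W p) hS t horth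

end Summit.BirchSwinnertonDyer.BirchSwinnertonDyer.Theorems.SignedEC.MuReal

end
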